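/-
Copyright: derived here (Resolution Observatory cell `pub-rosobs`, carver gen 60). AI-written Lean; AI review is
weaker than expert review.  Companion file of the cell's POLYNOMIAL weighted-centre model `W(f)` (engine 1's
`W(f)` / (P)-system TOY MODEL; CARVER-NOTES-eng1-g40 **T80 (c)** = THEOREM-F §4b L5 (i): "the forms `λ_j(y)^p =
Σ_t λ_{jt}^p y_t^p` are linearly independent — Frobenius is injective on `k` and commutes with determinants").
Instrument — NOT a resolution theorem and NOT a statement about the invariant of [AbramovichTemkinWlodarczyk2024].
-/
import Mathlib.FieldTheory.IsAlgClosed.AlgebraicClosure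
import Mathlib.FieldTheory.Perfect
import Mathlib.LinearAlgebra.LinearIndependent.BaseChange
import Mathlib.Algebra.MvPolynomial.CommRing
import Mathlib.RingTheory.MvPolynomial.Basic
import Mathlib.Algebra.CharP.Lemmas
import HarnessLib

/-!
# Frobenius keeps linearly independent vectors (and `p`-th powers of linear forms) independent

`k` a field of characteristic `p`.  L5 (i) of the cell's THEOREM-F §4b (THEOREM L-F₁) uses: if the linear forms
`λ_1, …, λ_r` in the variables `y_t` are linearly independent over `k`, then so are `λ_j(y)^p = Σ_t λ_{jt}^p y_t^p`,
"because Frobenius is injective on `k` and commutes with determinants"; and then a relation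
`Σ_j λ_j(y)^p · m_j = 0` with `y`-free `m_j` forces every `m_j = 0`.  Typed here, determinant-free:

* `linearIndependent_frobenius_comp` — for ANY field `k` of characteristic `p` and vectors `v_j ∈ k^n`
  (`n` finite): `(v_j)_j` linearly independent ⇒ `(Frob ∘ v_j)_j = ((v_{jt}^p)_t)_j` linearly independent.
  Proof: over a PERFECT field Frobenius is a ring automorphism and linear independence moves along the semilinear
  bijection (`linearIndependent_frobenius_comp_of_perfectRing`, via `LinearIndependent.map_of_surjective_injective`);
  a general `k` is first base-changed to its algebraic closure (`linearIndependent_algebraMap_comp_iff`), where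
  Frobenius commutes with the embedding.  [Lang2002, Ch. V §6: Frobenius injective; the independence statement and
  its formalisation are ours.]
* `frobeniusForm c := Σ_t C (c t ^ p) * X t ^ p = (Σ_t C (c t) * X t)^p` (`frobeniusForm_eq_pow`, `sum_pow_char`), and
  `linearIndependent_frobeniusForm` — `p`-th powers of linearly independent linear forms are linearly independent in
  `MvPolynomial τ k` (the monomials `y_t^p` are distinct basis vectors: `diagForm` is an injective linear map).
* `eq_zero_of_sum_smul_map_eq_zero` — SPLITTING: if `(u_j)_j` in `MvPolynomial τ k` are linearly independent over `k`
  and `Σ_j m_j • map C u_j = 0` in `MvPolynomial τ (MvPolynomial κ k)` with `m_j ∈ MvPolynomial κ k` ("`W`-free forms,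
  `y`-free coefficients"), then every `m_j = 0` — coefficientwise in the `κ`-monomials.

[AbramovichTemkinWlodarczyk2024, Thm. 5.3.1 (2)–(3)] context only: nothing here is a statement about weighted
blow-ups.
-/

namespace Literature.AlgebraicGeometry.Resolution.WeightedBlowup

namespace FrobeniusIndependence

section Vectors

variable {ι : Type*} {n : Type*}

/-- Over a PERFECT ring of characteristic `p`, Frobenius applied entrywise keeps a linearly independent family of
vectors `v_j ∈ K^n` linearly independent (derived here; semilinear transport along the bijection `frobeniusEquiv`).
[cite: Lang2002, Ch. V §6 (pp. 247–251)] -/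
theorem linearIndependent_frobenius_comp_of_perfectRing {K : Type*} [CommRing K] (p : ℕ) [ExpChar K p]
    [PerfectRing K p] {v : ι → n → K} (hv : LinearIndependent K v) :
    LinearIndependent K (fun j => frobenius K p ∘ v j) := by
  have h := hv.map_of_surjective_injective (frobenius K p) ((frobenius K p).compLeft n).toAddMonoidHom
    (frobeniusEquiv K p).surjective (fun m hm => ?_) (fun r m => ?_)
  · exact h
  · funext t
    have ht := congrFun hm t
    simp only [RingHom.toAddMonoidHom_eq_coe, AddMonoidHom.coe_coe, RingHom.compLeft_apply, Function.comp_apply,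
      Pi.zero_apply] at ht
    exact (frobeniusEquiv K p).injective (by rw [coe_frobeniusEquiv, ht, Pi.zero_apply, map_zero])
  · funext t
    simp only [RingHom.toAddMonoidHom_eq_coe, AddMonoidHom.coe_coe, RingHom.compLeft_apply, Function.comp_apply,
      Pi.smul_apply, smul_eq_mul, map_mul]

/-- **Frobenius keeps independent vectors independent** over ANY field `k` of characteristic `p` (derived here):
`(v_j)_j` linearly independent in `k^n` ⇒ `((v_{jt}^p)_t)_j` linearly independent.  Base change to the algebraic
closure (perfect), Frobenius there, and back. [cite: Lang2002, Ch. V §6 (pp. 247–251)] -/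
theorem linearIndependent_frobenius_comp [Finite n] {k : Type*} [Field k] (p : ℕ) [Fact p.Prime] [CharP k p]
    {v : ι → n → k} (hv : LinearIndependent k v) :
    LinearIndependent k (fun j => frobenius k p ∘ v j) := by
  set K := AlgebraicClosure k
  have hK : LinearIndependent K (fun j => algebraMap k K ∘ v j) := linearIndependent_algebraMap_comp_iff.mpr hv
  have hKF := linearIndependent_frobenius_comp_of_perfectRing (K := K) p hK
  have hcomm : (fun j => frobenius K p ∘ (algebraMap k K ∘ v j)) = fun j => algebraMap k K ∘ (frobenius k p ∘ v j) := by
    funext j t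
    simp only [Function.comp_apply, frobenius_def, map_pow]
  rw [hcomm] at hKF
  exact linearIndependent_algebraMap_comp_iff.mp hKF

end Vectors

section Forms

open MvPolynomial

variable {k : Type*} [CommRing k] {τ : Type*}

/-- The DIAGONAL FORM `Σ_t c_t · y_t^q` attached to a coefficient vector `c` (ours, bookkeeping); `q = 1`: the linear
form `Σ_t c_t y_t`. [cite: Lang2002, Ch. V §6 (pp. 247–251)] -/
noncomputable def diagForm [Fintype τ] (q : ℕ) : (τ → k) →ₗ[k] MvPolynomial τ k where
  toFun c := ∑ t, C (c t) * X t ^ q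
  map_add' c c' := by
    simp only [Pi.add_apply, map_add, add_mul, Finset.sum_add_distrib]
  map_smul' a c := by
    simp only [Pi.smul_apply, smul_eq_mul, map_mul, RingHom.id_apply, Finset.mul_sum, smul_eq_C_mul, mul_assoc]

/-- Unfolding (ours). [cite: Lang2002, Ch. V §6 (pp. 247–251)] -/
theorem diagForm_apply [Fintype τ] (q : ℕ) (c : τ → k) : diagForm q c = ∑ t, C (c t) * X t ^ q := rfl

/-- The coefficient of `y_t^q` in `Σ_u c_u y_u^q` is `c_t` (`q ≠ 0`; ours, bookkeeping).
[cite: Lang2002, Ch. V §6 (pp. 247–251)] -/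
theorem coeff_diagForm [Fintype τ] [DecidableEq τ] {q : ℕ} (hq : q ≠ 0) (c : τ → k) (t : τ) :
    coeff (Finsupp.single t q) (diagForm q c) = c t := by
  rw [diagForm_apply, coeff_sum, Finset.sum_eq_single t]
  · rw [C_mul_X_pow_eq_monomial, coeff_monomial, if_pos rfl]
  · intro u _ hut
    rw [C_mul_X_pow_eq_monomial, coeff_monomial, if_neg]
    intro h
    have := Finsupp.single_eq_single_iff _ _ _ _ |>.mp h
    rcases this with ⟨h1, _⟩ | ⟨h1, _⟩
    · exact hut h1
    · exact hq h1
  · intro ht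
    exact absurd (Finset.mem_univ t) ht

/-- `diagForm q` is injective for `q ≠ 0` (derived here). [cite: Lang2002, Ch. V §6 (pp. 247–251)] -/
theorem diagForm_injective [Fintype τ] {q : ℕ} (hq : q ≠ 0) : Function.Injective (diagForm (k := k) (τ := τ) q) := by
  classical
  intro c c' h
  funext t
  rw [← coeff_diagForm hq c t, ← coeff_diagForm hq c' t, h]

/-- `p`-TH POWER OF A LINEAR FORM in characteristic `p`: `(Σ_t c_t y_t)^p = Σ_t c_t^p y_t^p` (derived here;
`sum_pow_char`). [cite: Lang2002, Ch. V §6 (pp. 247–251)] -/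
theorem diagForm_one_pow [Fintype τ] (p : ℕ) [Fact p.Prime] [CharP k p] (c : τ → k) :
    (diagForm 1 c) ^ p = diagForm p (frobenius k p ∘ c) := by
  rw [diagForm_apply, diagForm_apply, sum_pow_char]
  refine Finset.sum_congr rfl fun t _ => ?_
  rw [mul_pow, ← map_pow, pow_one, Function.comp_apply, frobenius_def]

/-- **L5 (i), first half: `p`-th powers of linearly independent linear forms are linearly independent** over any
field of characteristic `p` (derived here): if the coefficient vectors `c_j` are linearly independent then so are the
forms `(Σ_t c_{jt} y_t)^p = Σ_t c_{jt}^p y_t^p`. [cite: Lang2002, Ch. V §6 (pp. 247–251)] -/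
theorem linearIndependent_diagForm_one_pow {K : Type*} [Field K] [Fintype τ] {ι : Type*} (p : ℕ) [Fact p.Prime]
    [CharP K p] {c : ι → τ → K} (hc : LinearIndependent K c) :
    LinearIndependent K (fun j => (diagForm 1 (c j)) ^ p) := by
  have h := (linearIndependent_frobenius_comp p hc).map' (diagForm p)
    (LinearMap.ker_eq_bot.mpr (diagForm_injective (Fact.out : p.Prime).ne_zero))
  have hfun : (fun j => (diagForm 1 (c j)) ^ p) = diagForm p ∘ (fun j => frobenius K p ∘ c j) := by
    funext j
    rw [Function.comp_apply, diagForm_one_pow]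
  rw [hfun]
  exact h

end Forms

section Splitting

open MvPolynomial

variable {k : Type*} [CommRing k] {τ κ ι : Type*}

/-- **L5 (i), second half (splitting `Σ_j u_j(y) · m_j(W) = 0`)** (derived here): if `(u_j)_j` in `k[y]` are linearly
independent over `k` (`j` in a finite index type) and `Σ_j m_j • u_j = 0` in `k[W][y]` with `m_j ∈ k[W]`, then every
`m_j = 0` — compare coefficients of each `W`-monomial. [cite: Lang2002, Ch. V §6 (pp. 247–251)] -/
theorem eq_zero_of_sum_smul_map_eq_zero [Fintype ι] {u : ι → MvPolynomial τ k} (hu : LinearIndependent k u)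
    (m : ι → MvPolynomial κ k)
    (h : ∑ j, m j • MvPolynomial.map (C : k →+* MvPolynomial κ k) (u j) = 0) (j : ι) : m j = 0 := by
  classical
  refine MvPolynomial.ext _ _ fun β => ?_
  rw [coeff_zero]
  -- for the `W`-monomial `β`: `Σ_j (coeff β m_j) • u_j = 0` in `k[y]`
  have hrel : ∑ i, coeff β (m i) • u i = 0 := by
    refine MvPolynomial.ext _ _ fun α => ?_
    have hα := congrArg (fun q => coeff β (coeff α q)) h
    simp only [coeff_sum, coeff_zero, coeff_smul, coeff_map, smul_eq_mul] at hα ⊢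
    rw [← hα]
    exact Finset.sum_congr rfl fun i _ => by rw [mul_comm (m i), coeff_C_mul, mul_comm]
  exact Fintype.linearIndependent_iff.mp hu (fun i => coeff β (m i)) hrel j

end Splitting

end FrobeniusIndependence

end Literature.AlgebraicGeometry.Resolution.WeightedBlowup
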